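import Mathlib
import Summits.Langlands.Langlands.Theses.TorsionKudlaMillsonWindow
import Literature.NumberTheory.Automorphic.QuaternionCoordOrder

/-!
# Piece `CongruenceCosetCapture` (stmt-Langlands-18923) of the decomposition of `FTraceCongruenceGeneration` (stmt-Langlands-13533) — birth skeleton

Two stubs:
* `stub_strongApproxModP` — STRONG APPROXIMATION for `B¹` (split at the complex place of `K`) in the
  form used: for a prime `p ∤ M` with `(p, 2ab) = 1` in `𝓞_F`, every `r ∈ O` with `r r̄ ≡ 1 (mod pO)`
  is congruent mod `pO` to some `γ ∈ Γ¹(M)` (Kneser 1965; Vignéras III Thm 4.3 — PROVED in the tree as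
  `Literature.NumberTheory.Automorphic.QuaternionAlgebra.finiteAdele_dense`, so this stub is provable now, size L);
* `stub_goodPrimeResidue` — a prime `p` and a residue `r` such that `nrd(t − σ_B t) ∉ C·F²` for every
  norm-one `t ≡ r (mod pO)` (Chebotarev in `F(√C)/F` + an explicit count in `(O/𝔭O)¹`).
`CongruenceCosetCapture_of` composes them with the two-sided-ideal calculus of `pO`, `MO` from
`Literature.NumberTheory.Automorphic.QuaternionCoordOrder` (no `sorry`): `t = xγ₀`, `M' = Mp`,
`t₁ = t`, `t₂ = tγ`.
-/

set_option linter.dupNamespace false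

namespace Summit.Langlands.Langlands.Cruxes.CongruenceCosetCapture.Birth

open Summit.Langlands.Langlands.Theses.TorsionKudlaMillsonWindow
open scoped Quaternion
open NumberField Literature.NumberTheory.Automorphic

/-- STUB: strong approximation modulo `p` for `Γ¹(M)`.  PLAN (tree support found 2026-08-17): this is a
direct consequence of Kneser's strong approximation theorem for `ℍ[K,a,b]¹`, which is PROVED in the tree in
finite-adelic coordinate form — `Literature.NumberTheory.Automorphic.QuaternionAlgebra.finiteAdele_dense`
(`QuaternionCoordOrderProofs.lean`; hypothesis `¬ IsTotallyDefinite`, here supplied by the complex place of `K`)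
— applied to the norm-one finite-adelic quaternion `y = (Hensel lift of r at 𝔮 ∣ p, 1 elsewhere)` (local lift as
in `QuaternionCoordOrderLocalLiftProofs.exists_sub_one_mem_and_sq_mul_eq_one`, `O_𝔮 ≅ M₂` for `𝔮 ∤ 2ab`) and the
open box `V = pM·𝒪̂_K`; integrality of the approximant from `x − y ∈ V` coordinatewise; membership in `Γ¹(M)` via
`QuaternionAlgebra.mem_congruenceSubgroup_span_singleton_iff`. [folklore] -/
theorem stub_strongApproxModP :
    ∀ (F K : Type) [Field F] [NumberField F] [Field K] [NumberField K] [Algebra F K] (σ : K ≃ₐ[F] K) (a b : NumberField.RingOfIntegers F), NumberField.IsTotallyReal F → Module.finrank F K = 2 → σ ≠ 1 → NumberField.InfinitePlace.nrComplexPlaces K = 1 → a ≠ 0 → b ≠ 0 → (∀ φ : K →+* ℂ, (starRingEnd ℂ).comp φ = φ → (φ (algebraMap F K a)).re < 0 ∧ (φ (algebraMap F K b)).re < 0) → (∀ φ : K →+* ℂ, (starRingEnd ℂ).comp φ ≠ φ → 0 < (φ (algebraMap F K a)).re ∨ 0 < (φ (algebraMap F K b)).re) → let a' : K := algebraMap F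 K a; let b' : K := algebraMap F K b; (∀ y : QuaternionAlgebra K a' 0 b', y * star y = 0 → y = 0) → let IsInt : QuaternionAlgebra K a' 0 b' → Prop := fun x => ∀ i : Fin 4, QuaternionAlgebra.equivTuple a' 0 b' x i ∈ Set.range (algebraMap (NumberField.RingOfIntegers K) K); let IsG : (QuaternionAlgebra K a' 0 b')ˣ → Prop := fun u => IsInt (u : QuaternionAlgebra K a' 0 b') ∧ IsInt ((u⁻¹ : (QuaternionAlgebra K a' 0 b')ˣ) : QuaternionAlgebra K a' 0 b'); let Cong : ℕ → (QuaternionAlgebra K a' 0 b')ˣ → Prop := fun N u => IsG u ∧ ∀ i : Fin 4, QuaternionAlgebra.equivTuple a' 0 b' ((u : QuaternionAlgebra K a' 0 b') - 1) i ∈ Set.range (fun y : NumberField.RingOfIntegers K => (((N : NumberField.RingOfIntegers K) * y : NumberField.RingOfIntegers K) : K)); ∀ (M p : ℕ), 0 < M → Nat.Prime p → ¬ (p ∣ M) → Ideal.span {(p : NumberField.RingOfIntegers F)} ⊔ Ideal.span {(2 * a * b : NumberField.RingOfIntegers F)} = ⊤ → ∀ r : QuaternionAlgebra K a' 0 b',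 IsInt r → (∀ i : Fin 4, QuaternionAlgebra.equivTuple a' 0 b' (r * star r - 1) i ∈ Set.range (fun y : NumberField.RingOfIntegers K => (((p : NumberField.RingOfIntegers K) * y : NumberField.RingOfIntegers K) : K))) → ∃ γ : (QuaternionAlgebra K a' 0 b')ˣ, Cong M γ ∧ (γ : QuaternionAlgebra K a' 0 b') * star (γ : QuaternionAlgebra K a' 0 b') = 1 ∧ (∀ i : Fin 4, QuaternionAlgebra.equivTuple a' 0 b' ((γ : QuaternionAlgebra K a' 0 b') - r) i ∈ Set.range (fun y : NumberField.RingOfIntegers K => (((p : NumberField.RingOfIntegers K) * y : NumberField.RingOfIntegers K) : K))) := by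
  sorry

/-- STUB: a good prime and residue class on which the odd-part norm avoids `C·F²`. [folklore] -/
theorem stub_goodPrimeResidue :
    ∀ (F K : Type) [Field F] [NumberField F] [Field K] [NumberField K] [Algebra F K] (σ : K ≃ₐ[F] K) (a b : NumberField.RingOfIntegers F), NumberField.IsTotallyReal F → Module.finrank F K = 2 → σ ≠ 1 → NumberField.InfinitePlace.nrComplexPlaces K = 1 → a ≠ 0 → b ≠ 0 → (∀ φ : K →+* ℂ, (starRingEnd ℂ).comp φ = φ → (φ (algebraMap F K a)).re < 0 ∧ (φ (algebraMap F K b)).re < 0) → (∀ φ : K →+* ℂ, (starRingEnd ℂ).comp φ ≠ φ → 0 < (φ (algebraMap F K a)).re ∨ 0 < (φ (algebraMap F K b)).re) → let a' : K := algebraMap F K a; let b' : K := algebraMap F K b; (∀ y : QuaternionAlgebra K a' 0 b', y * star y = 0 → y = 0) → let IsInt : QuaternionAlgebra K a' 0 b' → Prop := fun x => ∀ i : Fin 4, QuaternionAlgebra.equivTuple a' 0 b' x i ∈ Set.range (algebraMap (NumberField.RingOfIntegers K) K); let IsG : (QuaternionAlgebra K a' 0 b')ˣ → Prop := fun u =>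 IsInt (u : QuaternionAlgebra K a' 0 b') ∧ IsInt ((u⁻¹ : (QuaternionAlgebra K a' 0 b')ˣ) : QuaternionAlgebra K a' 0 b'); let G1 : (QuaternionAlgebra K a' 0 b')ˣ → Prop := fun u => IsG u ∧ (u : QuaternionAlgebra K a' 0 b') * star (u : QuaternionAlgebra K a' 0 b') = 1; let sB : QuaternionAlgebra K a' 0 b' → QuaternionAlgebra K a' 0 b' := fun y => ⟨σ y.re, σ y.imI, σ y.imJ, σ y.imK⟩; ∀ (M : ℕ) (C : Finset F), 0 < M → ∃ (p : ℕ) (r : QuaternionAlgebra K a' 0 b'), Nat.Prime p ∧ ¬ (p ∣ M) ∧ Ideal.span {(p : NumberField.RingOfIntegers F)} ⊔ Ideal.span {(2 * a * b : NumberField.RingOfIntegers F)} = ⊤ ∧ IsInt r ∧ (∀ i : Fin 4, QuaternionAlgebra.equivTuple a' 0 b' (r * star r - 1) i ∈ Set.range (fun y : NumberField.RingOfIntegers K => (((p : NumberField.RingOfIntegers K) * y : NumberField.RingOfIntegers K) : K))) ∧ ∀ t : (QuaternionAlgebra K a' 0 b')ˣ, G1 t → (∀ i : Fin 4, QuaternionAlgebra.equivTuple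 a' 0 b' ((t : QuaternionAlgebra K a' 0 b') - r) i ∈ Set.range (fun y : NumberField.RingOfIntegers K => (((p : NumberField.RingOfIntegers K) * y : NumberField.RingOfIntegers K) : K))) → ∀ c ∈ C, ∀ f : F, (((t : QuaternionAlgebra K a' 0 b') - sB (t : QuaternionAlgebra K a' 0 b')) * star ((t : QuaternionAlgebra K a' 0 b') - sB (t : QuaternionAlgebra K a' 0 b'))).re ≠ algebraMap F K (c * f ^ 2) := by
  sorry

/-! ## Name-keyed aliases of the two stub statements — the hypotheses of `CongruenceCosetCapture_of`

The native skeleton audit (`#h21_check_skeleton`, run by `ledger skeleton check`) admits a hypothesis of the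
composing theorem only if its head constant is a registered obligation or is NAMED like a declared stub;
`__Registered.stub_X` is the statement of `stub_X` verbatim (same source text) under the stub's short name
(device of `AnomalousDissipation/…/Cruxes/CyclicWindLineLoud/Lines/birth.lean`; the gate-reserved `@[stub]`
attribute is not written by a planner). -/
namespace __Registered

/-- Alias of the statement of `stub_strongApproxModP`, keyed by the stub name. -/
abbrev stub_strongApproxModP : Prop :=
  ∀ (F K : Type) [Field F] [NumberField F] [Field K] [NumberField K] [Algebra F K] (σ : K ≃ₐ[F] K) (a b : NumberField.RingOfIntegers F), NumberField.IsTotallyReal F → Module.finrank F K = 2 → σ ≠ 1 → NumberField.InfinitePlace.nrComplexPlaces K = 1 → a ≠ 0 → b ≠ 0 → (∀ φ : K →+* ℂ, (starRingEnd ℂ).comp φ = φ → (φ (algebraMap F K a)).re < 0 ∧ (φ (algebraMap F K b)).re < 0) → (∀ φ : K →+* ℂ, (starRingEnd ℂ).comp φ ≠ φ → 0 < (φ (algebraMap F K a)).re ∨ 0 < (φ (algebraMap F K b)).re) → let a' : K := algebraMap F K a; let b' : K := algebraMap F K b; (∀ y : QuaternionAlgebra K a' 0 b', y * star y = 0 →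 y = 0) → let IsInt : QuaternionAlgebra K a' 0 b' → Prop := fun x => ∀ i : Fin 4, QuaternionAlgebra.equivTuple a' 0 b' x i ∈ Set.range (algebraMap (NumberField.RingOfIntegers K) K); let IsG : (QuaternionAlgebra K a' 0 b')ˣ → Prop := fun u => IsInt (u : QuaternionAlgebra K a' 0 b') ∧ IsInt ((u⁻¹ : (QuaternionAlgebra K a' 0 b')ˣ) : QuaternionAlgebra K a' 0 b'); let Cong : ℕ → (QuaternionAlgebra K a' 0 b')ˣ → Prop := fun N u => IsG u ∧ ∀ i : Fin 4, QuaternionAlgebra.equivTuple a' 0 b' ((u : QuaternionAlgebra K a' 0 b') - 1) i ∈ Set.range (fun y : NumberField.RingOfIntegers K => (((N : NumberField.RingOfIntegers K) * y : NumberField.RingOfIntegers K) : K)); ∀ (M p : ℕ), 0 < M → Nat.Prime p → ¬ (p ∣ M) → Ideal.span {(p : NumberField.RingOfIntegers F)} ⊔ Ideal.span {(2 * a * b : NumberField.RingOfIntegers F)} = ⊤ → ∀ r : QuaternionAlgebra K a' 0 b', IsInt r → (∀ i : Fin 4, QuaternionAlgebra.equivTuple a' 0 b' (r * star r - 1) i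 ∈ Set.range (fun y : NumberField.RingOfIntegers K => (((p : NumberField.RingOfIntegers K) * y : NumberField.RingOfIntegers K) : K))) → ∃ γ : (QuaternionAlgebra K a' 0 b')ˣ, Cong M γ ∧ (γ : QuaternionAlgebra K a' 0 b') * star (γ : QuaternionAlgebra K a' 0 b') = 1 ∧ (∀ i : Fin 4, QuaternionAlgebra.equivTuple a' 0 b' ((γ : QuaternionAlgebra K a' 0 b') - r) i ∈ Set.range (fun y : NumberField.RingOfIntegers K => (((p : NumberField.RingOfIntegers K) * y : NumberField.RingOfIntegers K) : K)))

/-- Alias of the statement of `stub_goodPrimeResidue`, keyed by the stub name. -/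
abbrev stub_goodPrimeResidue : Prop :=
  ∀ (F K : Type) [Field F] [NumberField F] [Field K] [NumberField K] [Algebra F K] (σ : K ≃ₐ[F] K) (a b : NumberField.RingOfIntegers F), NumberField.IsTotallyReal F → Module.finrank F K = 2 → σ ≠ 1 → NumberField.InfinitePlace.nrComplexPlaces K = 1 → a ≠ 0 → b ≠ 0 → (∀ φ : K →+* ℂ, (starRingEnd ℂ).comp φ = φ → (φ (algebraMap F K a)).re < 0 ∧ (φ (algebraMap F K b)).re < 0) → (∀ φ : K →+* ℂ, (starRingEnd ℂ).comp φ ≠ φ → 0 < (φ (algebraMap F K a)).re ∨ 0 < (φ (algebraMap F K b)).re) → let a' : K := algebraMap F K a; let b' : K := algebraMap F K b; (∀ y : QuaternionAlgebra K a' 0 b', y * star y = 0 → y = 0) → let IsInt : QuaternionAlgebra K a' 0 b' → Prop := fun x => ∀ i : Fin 4, QuaternionAlgebra.equivTuple a' 0 b' x i ∈ Set.range (algebraMap (NumberField.RingOfIntegers K) K); let IsG : (QuaternionAlgebra K a' 0 b')ˣ → Prop := fun u => IsInt (u : QuaternionAlgebra K a' 0 b') ∧ IsInt ((u⁻¹ :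 (QuaternionAlgebra K a' 0 b')ˣ) : QuaternionAlgebra K a' 0 b'); let G1 : (QuaternionAlgebra K a' 0 b')ˣ → Prop := fun u => IsG u ∧ (u : QuaternionAlgebra K a' 0 b') * star (u : QuaternionAlgebra K a' 0 b') = 1; let sB : QuaternionAlgebra K a' 0 b' → QuaternionAlgebra K a' 0 b' := fun y => ⟨σ y.re, σ y.imI, σ y.imJ, σ y.imK⟩; ∀ (M : ℕ) (C : Finset F), 0 < M → ∃ (p : ℕ) (r : QuaternionAlgebra K a' 0 b'), Nat.Prime p ∧ ¬ (p ∣ M) ∧ Ideal.span {(p : NumberField.RingOfIntegers F)} ⊔ Ideal.span {(2 * a * b : NumberField.RingOfIntegers F)} = ⊤ ∧ IsInt r ∧ (∀ i : Fin 4, QuaternionAlgebra.equivTuple a' 0 b' (r * star r - 1) i ∈ Set.range (fun y : NumberField.RingOfIntegers K => (((p : NumberField.RingOfIntegers K) * y : NumberField.RingOfIntegers K) : K))) ∧ ∀ t : (QuaternionAlgebra K a' 0 b')ˣ, G1 t → (∀ i : Fin 4, QuaternionAlgebra.equivTuple a' 0 b' ((t : QuaternionAlgebra K a' 0 b') - r)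 i ∈ Set.range (fun y : NumberField.RingOfIntegers K => (((p : NumberField.RingOfIntegers K) * y : NumberField.RingOfIntegers K) : K))) → ∀ c ∈ C, ∀ f : F, (((t : QuaternionAlgebra K a' 0 b') - sB (t : QuaternionAlgebra K a' 0 b')) * star ((t : QuaternionAlgebra K a' 0 b') - sB (t : QuaternionAlgebra K a' 0 b'))).re ≠ algebraMap F K (c * f ^ 2)

end __Registered

/-- **Composition** (kernel-checked, no `sorry` of its own): the two stub statements (as the name-keyed aliases
`__Registered.stub_*`) imply the piece `CongruenceCosetCapture` BY NAME. [folklore] -/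
theorem CongruenceCosetCapture_of :
    __Registered.stub_strongApproxModP → __Registered.stub_goodPrimeResidue →
      Summit.Langlands.Langlands.Theses.TorsionKudlaMillsonWindow.CongruenceCosetCapture := by
  intro hSA hGP
  dsimp only [__Registered.stub_strongApproxModP, __Registered.stub_goodPrimeResidue] at hSA hGP
  intro F K _ _ _ _ _ σ a b hF hK2 hσ hcx ha hb hneg hpos a' b' hdiv IsInt IsG Cong G1 sB Good M x C hM hx
  obtain ⟨p, r, hp, hpM, hcop, hrI, hrN, hAv⟩ := hGP F K σ a b hF hK2 hσ hcx ha hb hneg hpos hdiv M C hM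
  have hSA' := hSA F K σ a b hF hK2 hσ hcx ha hb hneg hpos hdiv M p hM hp hpM hcop
  -- the tree's coordinate order `O = 𝓞_K⟨1,i,j,k⟩`; the route predicates are its membership, by `rfl`
  set A : 𝓞 K := algebraMap (𝓞 F) (𝓞 K) a with hA
  set Bb : 𝓞 K := algebraMap (𝓞 F) (𝓞 K) b with hBb
  have hG1 : ∀ u : (ℍ[K, a', b'])ˣ, G1 u ↔ u ∈ QuaternionAlgebra.normOneGroup (R := 𝓞 K) K A Bb :=
    fun u => Iff.rfl
  have hInt : ∀ z : ℍ[K, a', b'], IsInt z ↔ z ∈ QuaternionAlgebra.coordOrder (R := 𝓞 K) K A Bb :=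
    fun z => Iff.rfl
  -- coordinates in `N · 𝓞_K` = membership in the two-sided ideal `N O`
  have hL : ∀ (N : 𝓞 K) (z : ℍ[K, a', b']),
      (∀ i : Fin 4, QuaternionAlgebra.equivTuple a' 0 b' z i ∈
        Set.range (fun y : 𝓞 K => (((N * y : 𝓞 K)) : K))) ↔
      z ∈ QuaternionAlgebra.idealLattice (R := 𝓞 K) K A Bb (Ideal.span {N}) := by
    intro N z
    have hS : Set.range (fun y : 𝓞 K => (((N * y : 𝓞 K)) : K)) =
        (algebraMap (𝓞 K) K) '' ((Ideal.span {N} : Ideal (𝓞 K)) : Set (𝓞 K)) := by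
      ext w
      simp only [Set.mem_image, SetLike.mem_coe, Ideal.mem_span_singleton', Set.mem_range]
      constructor
      · rintro ⟨y, rfl⟩; exact ⟨N * y, ⟨y, mul_comm y N⟩, rfl⟩
      · rintro ⟨_, ⟨y, rfl⟩, rfl⟩; exact ⟨y, by rw [mul_comm]⟩
    rw [hS]
    exact Iff.rfl
  have hLmono : ∀ (N N' : 𝓞 K), N ∣ N' → ∀ z : ℍ[K, a', b'],
      z ∈ QuaternionAlgebra.idealLattice (R := 𝓞 K) K A Bb (Ideal.span {N'}) →
      z ∈ QuaternionAlgebra.idealLattice (R := 𝓞 K) K A Bb (Ideal.span {N}) := by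
    intro N N' hNN' z hz
    have hle : ((Ideal.span {N'} : Ideal (𝓞 K)) : Set (𝓞 K)) ⊆ ((Ideal.span {N} : Ideal (𝓞 K)) : Set (𝓞 K)) :=
      SetLike.coe_subset_coe.mpr (Ideal.span_singleton_le_span_singleton.mpr hNN')
    refine QuaternionAlgebra.mem_idealLattice_iff.mpr fun i => ?_
    obtain ⟨w, hw, hwe⟩ := QuaternionAlgebra.mem_idealLattice_iff.mp hz i
    exact ⟨w, hle hw, hwe⟩
  -- base point of the good residue class inside the coset `x Γ¹(M)`: `t = x γ₀`, `γ₀ ≡ x⁻¹ r (mod p O)`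
  have hxinv : (x⁻¹ : (ℍ[K, a', b'])ˣ) ∈ QuaternionAlgebra.normOneGroup (R := 𝓞 K) K A Bb :=
    Subgroup.inv_mem _ ((hG1 x).mp hx)
  set r' : ℍ[K, a', b'] := ((x⁻¹ : (ℍ[K, a', b'])ˣ) : ℍ[K, a', b']) * r with hr'
  have hr'I : IsInt r' :=
    (hInt r').mpr ((QuaternionAlgebra.coordOrder (R := 𝓞 K) K A Bb).mul_mem hxinv.1.1 ((hInt r).mp hrI))
  have hr'N : ∀ i : Fin 4, QuaternionAlgebra.equivTuple a' 0 b' (r' * star r' - 1) i ∈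
      Set.range (fun y : 𝓞 K => ((((p : 𝓞 K) * y : 𝓞 K)) : K)) := by
    rw [hL]
    have h1 : ((x⁻¹ : (ℍ[K, a', b'])ˣ) : ℍ[K, a', b']) * star ((x⁻¹ : (ℍ[K, a', b'])ˣ) : ℍ[K, a', b']) = 1 :=
      hxinv.2
    have hcalc : r' * star r' - 1 = ((x⁻¹ : (ℍ[K, a', b'])ˣ) : ℍ[K, a', b']) * (r * star r - 1) *
        star ((x⁻¹ : (ℍ[K, a', b'])ˣ) : ℍ[K, a', b']) := by
      rw [hr', star_mul, mul_sub, sub_mul, mul_one, h1]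
      noncomm_ring
    rw [hcalc]
    exact QuaternionAlgebra.idealLattice_mul_mem
      (QuaternionAlgebra.mul_idealLattice_mem hxinv.1.1 ((hL _ _).mp hrN))
      (QuaternionAlgebra.star_mem_coordOrder hxinv.1.1)
  obtain ⟨γ₀, hγ₀C, hγ₀1, hγ₀r⟩ := hSA' r' hr'I hr'N
  have hγ₀G : γ₀ ∈ QuaternionAlgebra.normOneGroup (R := 𝓞 K) K A Bb := ⟨hγ₀C.1, hγ₀1⟩
  have hxG : x ∈ QuaternionAlgebra.normOneGroup (R := 𝓞 K) K A Bb := (hG1 x).mp hx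
  set t : (ℍ[K, a', b'])ˣ := x * γ₀ with ht
  have htG : t ∈ QuaternionAlgebra.normOneGroup (R := 𝓞 K) K A Bb := Subgroup.mul_mem _ hxG hγ₀G
  -- `t ≡ r (mod p O)`
  have htr : (t : ℍ[K, a', b']) - r ∈
      QuaternionAlgebra.idealLattice (R := 𝓞 K) K A Bb (Ideal.span {(p : 𝓞 K)}) := by
    have hcalc : (t : ℍ[K, a', b']) - r = (x : ℍ[K, a', b']) * ((γ₀ : ℍ[K, a', b']) - r') := by
      rw [ht, Units.val_mul, hr', mul_sub, Units.mul_inv_cancel_left]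
    rw [hcalc]
    exact QuaternionAlgebra.mul_idealLattice_mem hxG.1.1 ((hL _ _).mp hγ₀r)
  -- `t ≡ x (mod M O)`
  have htx : (t : ℍ[K, a', b']) - x ∈
      QuaternionAlgebra.idealLattice (R := 𝓞 K) K A Bb (Ideal.span {(M : 𝓞 K)}) := by
    have hcalc : (t : ℍ[K, a', b']) - x = (x : ℍ[K, a', b']) * ((γ₀ : ℍ[K, a', b']) - 1) := by
      rw [ht, Units.val_mul, mul_sub, mul_one]
    rw [hcalc]
    exact QuaternionAlgebra.mul_idealLattice_mem hxG.1.1 ((hL _ _).mp hγ₀C.2)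
  refine ⟨M * p, Nat.mul_pos hM hp.pos, fun γ hγ hγ1 => ⟨t, t * γ, ?_, ?_, (inv_mul_cancel_left t γ).symm⟩⟩
  · -- `t ∈ Good`
    exact ⟨(hG1 t).mpr htG, (hL _ _).mpr htx, hAv t ((hG1 t).mpr htG) ((hL _ _).mpr htr)⟩
  · -- `t γ ∈ Good` for `γ ∈ Γ¹(M p)`
    have hγG : γ ∈ QuaternionAlgebra.normOneGroup (R := 𝓞 K) K A Bb := ⟨hγ.1, hγ1⟩
    have htγG : t * γ ∈ QuaternionAlgebra.normOneGroup (R := 𝓞 K) K A Bb := Subgroup.mul_mem _ htG hγG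
    have hγ1' : (γ : ℍ[K, a', b']) - 1 ∈
        QuaternionAlgebra.idealLattice (R := 𝓞 K) K A Bb (Ideal.span {((M * p : ℕ) : 𝓞 K)}) :=
      (hL _ _).mp hγ.2
    have hγM : (γ : ℍ[K, a', b']) - 1 ∈
        QuaternionAlgebra.idealLattice (R := 𝓞 K) K A Bb (Ideal.span {(M : 𝓞 K)}) :=
      hLmono _ _ ⟨(p : 𝓞 K), by push_cast; ring⟩ _ hγ1'
    have hγp : (γ : ℍ[K, a', b']) - 1 ∈
        QuaternionAlgebra.idealLattice (R := 𝓞 K) K A Bb (Ideal.span {(p : 𝓞 K)}) :=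
      hLmono _ _ ⟨(M : 𝓞 K), by push_cast; ring⟩ _ hγ1'
    have htγx : ((t * γ : (ℍ[K, a', b'])ˣ) : ℍ[K, a', b']) - x ∈
        QuaternionAlgebra.idealLattice (R := 𝓞 K) K A Bb (Ideal.span {(M : 𝓞 K)}) := by
      have hcalc : ((t * γ : (ℍ[K, a', b'])ˣ) : ℍ[K, a', b']) - x =
          ((t : ℍ[K, a', b']) - x) * (γ : ℍ[K, a', b']) + (x : ℍ[K, a', b']) * ((γ : ℍ[K, a', b']) - 1) := by
        rw [Units.val_mul]; noncomm_ring
      rw [hcalc]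
      exact add_mem (QuaternionAlgebra.idealLattice_mul_mem htx hγG.1.1)
        (QuaternionAlgebra.mul_idealLattice_mem hxG.1.1 hγM)
    have htγr : ((t * γ : (ℍ[K, a', b'])ˣ) : ℍ[K, a', b']) - r ∈
        QuaternionAlgebra.idealLattice (R := 𝓞 K) K A Bb (Ideal.span {(p : 𝓞 K)}) := by
      have hcalc : ((t * γ : (ℍ[K, a', b'])ˣ) : ℍ[K, a', b']) - r =
          ((t : ℍ[K, a', b']) - r) + (t : ℍ[K, a', b']) * ((γ : ℍ[K, a', b']) - 1) := by
        rw [Units.val_mul]; noncomm_ring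
      rw [hcalc]
      exact add_mem htr (QuaternionAlgebra.mul_idealLattice_mem htG.1.1 hγp)
    exact ⟨(hG1 _).mpr htγG, (hL _ _).mpr htγx, hAv (t * γ) ((hG1 _).mpr htγG) ((hL _ _).mpr htγr)⟩

/-- WIRING CHECK: the two sorried stubs compose to a closed term of the piece's type (modulo their `sorry`s);
an `example`, so no pre-composed constant of type `CongruenceCosetCapture` enters an importing environment. -/
example : Summit.Langlands.Langlands.Theses.TorsionKudlaMillsonWindow.CongruenceCosetCapture :=
  CongruenceCosetCapture_of stub_strongApproxModP stub_goodPrimeResidue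

end Summit.Langlands.Langlands.Cruxes.CongruenceCosetCapture.Birth
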